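import Summits.CriticalPhenomena.CardyFormulaZ2.Theorems.CardyIKTransportIKMixedBoxCrossingDefectGlueDefs
import Summits.CriticalPhenomena.CardyFormulaZ2.Theorems.CardyIKTransportIKMixedBoxCrossingDefectStubBridgeLaw
import Summits.CriticalPhenomena.CardyFormulaZ2.Theorems.CardyIKTransportIKMixedBoxCrossingStubPatternLocality

/-!
# Stub `stub_bridgeOfLaw` of the line `defect-closure-exploration` (crux `IKMixedBoxCrossing`, stmt-CriticalPhenomena-5911)

TRANSPORT half of the gauge bridge: `BridgeLaw → GaugeBridge`.

* GAUGE SIDE to the origin: `pLR S a b W H = pLR {x | x + a ∈ S} 0 0 W H` (landed `StubPatternLocality.recentre`).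
* FREE SIDE to the origin (`free_recentre`): relabel cells and faces by the translation `Site.shift ![a, b]`;
  `cornerGibbsMeasure_map_relabel` / `coinMeasure_map_relabel` carry `boxLaw {x | x + a ∈ S} (cellRect 0 0 W H)` onto
  `boxLaw S (cellRect a b W H)` (`boxLaw_map_rel`), and the observables `toObs` of the free model (black cells, anti faces;
  `blackEdges ∘ toObs S = mixedEdges S` definitionally) are shift-covariant (`toObs_rel`), so the crossing events correspond
  (`shiftObs_mem_lrCross`).
* AT THE ORIGIN (`origin_bridge`): the crossing events of the `W × H` box only read the colours and anti flags of the box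
  cells (`cross_congr_of_box`), hence are preimages of ONE event of `BoxData W H` under `gaugeBox` / `freeBox`
  (decoded by `ofBox`); `BridgeLaw` and `Measure.map_apply` finish.
-/

noncomputable section

namespace Summit.CriticalPhenomena.CardyFormulaZ2.Cruxes.IKMixedBoxCrossing.DefectClosureExploration

open scoped Classical
open MeasureTheory
open Literature.Probability.Percolation Literature.Probability.LatticeModels
open Summit.CriticalPhenomena.CardyFormulaZ2.Theorems.IKLinearTransport.PinnedDiagramExchange
  (Ω μIK blackSet antiSet Obs obs blackEdges lrCross tbCross)
open Summit.CriticalPhenomena.CardyFormulaZ2.Theorems.IKLinearTransport.PinnedDiagramExchange.CouplingToLimits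
  (mk_mem_blackEdges_iff)
open Summit.CriticalPhenomena.CardyFormulaZ2.Cruxes.IKMixedBoxCrossing.PairedMirrorExploration
  (pLR pTB pLR_two_mul_eq_pH pTB_two_mul_eq_pV)
open Summit.CriticalPhenomena.CardyFormulaZ2.Cruxes.IKMixedBoxCrossing.PairedMirrorExploration.StubPatternLocality
  (shiftObs shiftObs_mem_lrCross shiftObs_mem_tbCross mem_openCrossing_congr recentre)
open Summit.CriticalPhenomena.CardyFormulaZ2.Cruxes.IKMixedBoxCrossing.PairedMirrorExploration.DualityStub
  (measurableSet_lrCross measurableSet_tbCross)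
open BridgeLawStub (site site_injective exists_site_eq measurable_gaugeBox measurable_freeBox)

namespace BridgeOfLawStub

/-! ## §1 Observables of the free model -/

/-- Observables of a free-model configuration: black cells and anti-diagonal faces (so that
`blackEdges (toObs S x) = mixedEdges S x` definitionally). -/
def toObs (S : Set ℤ) (x : CellConfig) : Obs := ({v | x.1 v = true}, antiFaces S x.2)

/-- The free LR event is the preimage of the gauge's LR event under `toObs` (definitional). -/
theorem lrEvent_eq (S : Set ℤ) (a b : ℤ) (W H : ℕ) : lrEvent S a b W H = toObs S ⁻¹' lrCross a b W H := rfl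

/-- The free TB event is the preimage of the gauge's TB event under `toObs` (definitional). -/
theorem tbEvent_eq (S : Set ℤ) (a b : ℤ) (W H : ℕ) : tbEvent S a b W H = toObs S ⁻¹' tbCross a b W H := rfl

/-- Reading a cell (or a coin) is measurable. -/
theorem measurable_apply_eq_true (v : Site 2) : Measurable fun σ : Site 2 → Bool => σ v = true := by
  have h : MeasurableSet ((fun σ : Site 2 → Bool => σ v) ⁻¹' {true}) :=
    (measurable_pi_apply v) (measurableSet_singleton true)
  exact measurableSet_setOf.1 h

/-- `toObs` is measurable. -/
theorem measurable_toObs (S : Set ℤ) : Measurable (toObs S) := by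
  refine Measurable.prodMk (measurable_set_iff.2 fun v => ?_) (measurable_set_iff.2 fun f => ?_)
  · exact (measurable_apply_eq_true v).comp measurable_fst
  · simp only [antiFaces, Set.mem_setOf_eq]
    exact measurable_const.or ((measurable_apply_eq_true f).comp measurable_snd)

/-! ## §2 The free side: translation to the origin -/

/-- Membership in a cell rectangle. -/
theorem mem_cellRect {a b : ℤ} {W H : ℕ} {v : Site 2} :
    v ∈ cellRect a b W H ↔ a ≤ v 0 ∧ v 0 < a + W ∧ b ≤ v 1 ∧ v 1 < b + H := by
  simp only [cellRect, Finset.mem_image, Finset.mem_product, Finset.mem_Ico]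
  exact ⟨fun ⟨p, ⟨⟨h1, h2⟩, h3, h4⟩, hp⟩ => hp ▸ ⟨h1, h2, h3, h4⟩,
    fun ⟨h1, h2, h3, h4⟩ => ⟨(v 0, v 1), ⟨⟨h1, h2⟩, h3, h4⟩, Contour.site_ext rfl rfl⟩⟩

/-- The rectangle at `(a, b)` is the translate of the rectangle at the origin. -/
theorem image_shift_cellRect (a b : ℤ) (W H : ℕ) :
    (cellRect 0 0 W H).image (Site.shift ![a, b]) = cellRect a b W H := by
  ext v
  simp only [Finset.mem_image, mem_cellRect, Site.shift_apply]
  constructor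
  · rintro ⟨u, ⟨h1, h2, h3, h4⟩, rfl⟩
    simp only [Pi.add_apply, Matrix.cons_val_zero, Matrix.cons_val_one]
    omega
  · rintro ⟨h1, h2, h3, h4⟩
    refine ⟨v - ![a, b], ?_, sub_add_cancel v _⟩
    simp only [Pi.sub_apply, Matrix.cons_val_zero, Matrix.cons_val_one]
    omega

/-- The interaction faces at `(a, b)` are the translates of those at the origin for the shifted pattern. -/
theorem image_shift_facesIn (S : Set ℤ) (a b : ℤ) (W H : ℕ) :
    (facesIn {z | z + a ∈ S} (cellRect 0 0 W H)).image (Site.shift ![a, b]) = facesIn S (cellRect a b W H) := by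
  rw [facesIn, facesIn, ← image_shift_cellRect a b W H, innerVertices_image (image_cellFace_shift ![a, b]),
    Finset.filter_image]
  rfl

/-- Relabelling of a free-model configuration (colours and coins) by the translation `t`. -/
def rel (t : Site 2) : CellConfig → CellConfig :=
  Prod.map (fun σ : Site 2 → Bool => σ ∘ ⇑(Site.shift t).symm) (fun κ : Site 2 → Bool => κ ∘ ⇑(Site.shift t).symm)

/-- `rel` is measurable. -/
theorem measurable_rel (t : Site 2) : Measurable (rel t) := (measurable_relabel _).prodMap (measurable_relabel _)

/-- TRANSLATION COVARIANCE OF THE FREE LAW: relabelling by `![a, b]` carries the free model of the box at the origin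
(shifted pattern) onto the free model of the box at `(a, b)`. -/
theorem boxLaw_map_rel (S : Set ℤ) (a b : ℤ) (W H : ℕ) :
    (boxLaw {z | z + a ∈ S} (cellRect 0 0 W H)).map (rel ![a, b]) = boxLaw S (cellRect a b W H) := by
  rw [boxLaw, boxLaw, colourLaw, colourLaw, rel,
    ← Measure.map_prod_map _ _ (measurable_relabel _) (measurable_relabel _),
    cornerGibbsMeasure_map_relabel (image_cellFace_shift ![a, b]), image_shift_facesIn, image_shift_cellRect,
    coinMeasure_map_relabel]
  rfl

/-- The observables of the relabelled configuration are the shifted observables (pattern shifted along). -/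
theorem toObs_rel (S : Set ℤ) (t : Site 2) (x : CellConfig) :
    toObs S (rel t x) = shiftObs t (toObs {z | z + t 0 ∈ S} x) := by
  refine Prod.ext (Set.ext fun v => ?_) (Set.ext fun f => ?_)
  · simp only [toObs, rel, shiftObs, Prod.map_fst, Set.mem_setOf_eq, Function.comp_apply,
      Site.shift_symm_apply, Set.mem_preimage]
  · simp only [toObs, rel, shiftObs, antiFaces, Prod.map_snd, Set.mem_setOf_eq, Function.comp_apply,
      Site.shift_symm_apply, Set.mem_preimage, Pi.sub_apply, sub_add_cancel]

/-- FREE SIDE TO THE ORIGIN: the free crossing probabilities of the box at `(a, b)` are those of the box at the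
origin for the shifted pattern. -/
theorem free_recentre (S : Set ℤ) (a b : ℤ) (W H : ℕ) :
    hfree S a b W H = hfree {z | z + a ∈ S} 0 0 W H ∧ vfree S a b W H = vfree {z | z + a ∈ S} 0 0 W H := by
  have hobs : ∀ x, toObs S (rel ![a, b] x) = shiftObs ![a, b] (toObs {z | z + a ∈ S} x) := fun x => by
    simpa only [Matrix.cons_val_zero] using toObs_rel S ![a, b] x
  rw [hfree, hfree, vfree, vfree, ← boxLaw_map_rel S a b W H, lrEvent_eq, lrEvent_eq, tbEvent_eq, tbEvent_eq,
    map_measureReal_apply (measurable_rel _) (measurable_toObs S (measurableSet_lrCross a b W H)),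
    map_measureReal_apply (measurable_rel _) (measurable_toObs S (measurableSet_tbCross a b W H))]
  refine ⟨congrArg _ (Set.ext fun x => ?_), congrArg _ (Set.ext fun x => ?_)⟩
  · simp only [Set.mem_preimage, hobs]
    simpa only [Matrix.cons_val_zero, Matrix.cons_val_one, zero_add] using
      shiftObs_mem_lrCross ![a, b] 0 0 W H (toObs {z | z + a ∈ S} x)
  · simp only [Set.mem_preimage, hobs]
    simpa only [Matrix.cons_val_zero, Matrix.cons_val_one, zero_add] using
      shiftObs_mem_tbCross ![a, b] 0 0 W H (toObs {z | z + a ∈ S} x)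

/-! ## §3 At the origin: the crossing events read one event of the box data -/

/-- BOX LOCALITY of the crossing events at the origin: observables agreeing on the colours and anti flags of the
cells of `[0, W) × [0, H)` have the same crossings (edges with both ends in the box read the anti flags of the faces
`u` and `u + (0,-1)` with `u + (1,1)`, resp. `u + (1,-1)`, in the box — such faces are box cells). -/
theorem cross_congr_of_box {W H : ℕ} {x y : Obs}
    (h : ∀ v : Site 2, 0 ≤ v 0 → v 0 < W → 0 ≤ v 1 → v 1 < H → ((v ∈ x.1 ↔ v ∈ y.1) ∧ (v ∈ x.2 ↔ v ∈ y.2))) :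
    (x ∈ lrCross 0 0 W H ↔ y ∈ lrCross 0 0 W H) ∧ (x ∈ tbCross 0 0 W H ↔ y ∈ tbCross 0 0 W H) := by
  have clause : ∀ p q : Site 2, p ∈ {v : Site 2 | 0 ≤ v 0 ∧ v 0 < 0 + W ∧ 0 ≤ v 1 ∧ v 1 < 0 + H} →
      q ∈ {v : Site 2 | 0 ≤ v 0 ∧ v 0 < 0 + W ∧ 0 ≤ v 1 ∧ v 1 < 0 + H} →
      ((p ∈ x.1 ∧ q ∈ x.1 ∧ (q = p + ![1, 0] ∨ q = p + ![0, 1] ∨ (q = p + ![1, 1] ∧ ¬ p ∈ x.2) ∨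
          (q = p + ![1, -1] ∧ (p + ![0, -1]) ∈ x.2))) ↔
        (p ∈ y.1 ∧ q ∈ y.1 ∧ (q = p + ![1, 0] ∨ q = p + ![0, 1] ∨ (q = p + ![1, 1] ∧ ¬ p ∈ y.2) ∨
          (q = p + ![1, -1] ∧ (p + ![0, -1]) ∈ y.2)))) := by
    intro p q hp hq
    simp only [Set.mem_setOf_eq, zero_add] at hp hq
    obtain ⟨hp1, hp2⟩ := h p hp.1 hp.2.1 hp.2.2.1 hp.2.2.2
    obtain ⟨hq1, -⟩ := h q hq.1 hq.2.1 hq.2.2.1 hq.2.2.2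
    have hd : q = p + ![1, -1] → ((p + ![0, -1]) ∈ x.2 ↔ (p + ![0, -1]) ∈ y.2) := fun hqp => by
      subst hqp
      simp only [Pi.add_apply, Matrix.cons_val_zero, Matrix.cons_val_one] at hq
      refine (h _ ?_ ?_ ?_ ?_).2 <;>
        simp only [Pi.add_apply, Matrix.cons_val_zero, Matrix.cons_val_one] <;> omega
    rw [hp1, hq1, hp2]
    exact and_congr_right' (and_congr_right' (or_congr_right (or_congr_right (or_congr_right
      (and_congr_right hd)))))
  have key : ∀ u ∈ {v : Site 2 | 0 ≤ v 0 ∧ v 0 < 0 + W ∧ 0 ≤ v 1 ∧ v 1 < 0 + H},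
      ∀ v ∈ {v : Site 2 | 0 ≤ v 0 ∧ v 0 < 0 + W ∧ 0 ≤ v 1 ∧ v 1 < 0 + H},
        (s(u, v) ∈ blackEdges x ↔ s(u, v) ∈ blackEdges y) := fun u hu v hv => by
    rw [mk_mem_blackEdges_iff, mk_mem_blackEdges_iff]
    exact or_congr (clause u v hu hv) (clause v u hv hu)
  exact ⟨mem_openCrossing_congr key, mem_openCrossing_congr key⟩

/-- DECODING box data into observables: black box cells, anti flags of box faces (forced off `S` as in the gauge). -/
def ofBox (S : Set ℤ) {W H : ℕ} (d : BoxData W H) : Obs :=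
  ({v | ∃ q : Fin W × Fin H, site q = v ∧ d.1 q = true}, {f | f 0 ∉ S ∨ ∃ q : Fin W × Fin H, site q = f ∧ d.2 q = true})

/-- Colour of a box cell of the decoded observables. -/
theorem site_mem_ofBox_fst {S : Set ℤ} {W H : ℕ} {d : BoxData W H} {q : Fin W × Fin H} :
    site q ∈ (ofBox S d).1 ↔ d.1 q = true := by
  simp only [ofBox, Set.mem_setOf_eq, site_injective.eq_iff, exists_eq_left]

/-- Anti flag of a box face of the decoded observables. -/
theorem site_mem_ofBox_snd {S : Set ℤ} {W H : ℕ} {d : BoxData W H} {q : Fin W × Fin H} :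
    site q ∈ (ofBox S d).2 ↔ site q 0 ∉ S ∨ d.2 q = true := by
  simp only [ofBox, Set.mem_setOf_eq, site_injective.eq_iff, exists_eq_left]

/-- The gauge's box colours, read back. -/
theorem gaugeBox_fst {S : Set ℤ} {W H : ℕ} {ω : Ω} {q : Fin W × Fin H} :
    (gaugeBox S W H ω).1 q = true ↔ site q ∈ blackSet S ω := by
  simp only [gaugeBox, site, decide_eq_true_eq]

/-- The gauge's box coins, read back. -/
theorem gaugeBox_snd {S : Set ℤ} {W H : ℕ} {ω : Ω} {q : Fin W × Fin H} :
    (gaugeBox S W H ω).2 q = true ↔ site q ∈ ω.2.2.2.2 := by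
  simp only [gaugeBox, site, decide_eq_true_eq]

/-- GAUGE: the crossing events at the origin are read from the box data. -/
theorem obs_congr (S : Set ℤ) (W H : ℕ) (ω : Ω) :
    (obs S ω ∈ lrCross 0 0 W H ↔ ofBox S (gaugeBox S W H ω) ∈ lrCross 0 0 W H) ∧
      (obs S ω ∈ tbCross 0 0 W H ↔ ofBox S (gaugeBox S W H ω) ∈ tbCross 0 0 W H) := by
  refine cross_congr_of_box fun v h0 hW h1 hH => ?_
  obtain ⟨q, rfl⟩ := exists_site_eq h0 hW h1 hH
  rw [site_mem_ofBox_fst, site_mem_ofBox_snd, gaugeBox_fst, gaugeBox_snd]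
  exact ⟨Iff.rfl, Iff.rfl⟩

/-- FREE MODEL: the crossing events at the origin are read from the box data. -/
theorem toObs_congr (S : Set ℤ) (W H : ℕ) (x : CellConfig) :
    (toObs S x ∈ lrCross 0 0 W H ↔ ofBox S (freeBox W H x) ∈ lrCross 0 0 W H) ∧
      (toObs S x ∈ tbCross 0 0 W H ↔ ofBox S (freeBox W H x) ∈ tbCross 0 0 W H) := by
  refine cross_congr_of_box fun v h0 hW h1 hH => ?_
  obtain ⟨q, rfl⟩ := exists_site_eq h0 hW h1 hH
  rw [site_mem_ofBox_fst, site_mem_ofBox_snd]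
  exact ⟨Iff.rfl, Iff.rfl⟩

/-- AT THE ORIGIN: `BridgeLaw` identifies the gauge and free crossing probabilities of the box `[0, W) × [0, H)`. -/
theorem origin_bridge (hBL : BridgeLaw) (S : Set ℤ) (W H : ℕ) :
    pLR S 0 0 W H = hfree S 0 0 W H ∧ pTB S 0 0 W H = vfree S 0 0 W H := by
  have hg : ∀ E : Set (BoxData W H),
      μIK.real (gaugeBox S W H ⁻¹' E) = (boxLaw S (cellRect 0 0 W H)).real (freeBox W H ⁻¹' E) := fun E => by
    rw [← map_measureReal_apply (measurable_gaugeBox S W H) MeasurableSet.of_discrete, hBL S W H,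
      map_measureReal_apply (measurable_freeBox W H) MeasurableSet.of_discrete]
  have e1 : obs S ⁻¹' lrCross 0 0 W H = gaugeBox S W H ⁻¹' (ofBox S ⁻¹' lrCross 0 0 W H) :=
    Set.ext fun ω => (obs_congr S W H ω).1
  have e2 : obs S ⁻¹' tbCross 0 0 W H = gaugeBox S W H ⁻¹' (ofBox S ⁻¹' tbCross 0 0 W H) :=
    Set.ext fun ω => (obs_congr S W H ω).2
  have e3 : toObs S ⁻¹' lrCross 0 0 W H = freeBox W H ⁻¹' (ofBox S ⁻¹' lrCross 0 0 W H) :=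
    Set.ext fun x => (toObs_congr S W H x).1
  have e4 : toObs S ⁻¹' tbCross 0 0 W H = freeBox W H ⁻¹' (ofBox S ⁻¹' tbCross 0 0 W H) :=
    Set.ext fun x => (toObs_congr S W H x).2
  rw [pLR, pTB, hfree, vfree, lrEvent_eq, tbEvent_eq, e1, e2, e3, e4]
  exact ⟨hg _, hg _⟩

end BridgeOfLawStub

open BridgeOfLawStub in
/-- **Registered stub `stub_bridgeOfLaw`** (line `defect-closure-exploration`): the law identity at the origin
(`BridgeLaw`) transports to every position and to the crux's crossing events — `Negative.pH = hfree`,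
`Negative.pV = vfree` (`GaugeBridge`): the gauge side is recentred by pattern locality, the free side by relabelling
the corner Gibbs measure and the coins, and at the origin both crossing events read the same event of the box data. -/
theorem stub_bridgeOfLaw : BridgeLaw → GaugeBridge := by
  intro hBL S n a b
  rw [← pLR_two_mul_eq_pH, ← pTB_two_mul_eq_pV, (recentre S a b (2 * n) n).1, (recentre S a b n (2 * n)).2,
    (free_recentre S a b (2 * n) n).1, (free_recentre S a b n (2 * n)).2]
  exact ⟨(origin_bridge hBL _ (2 * n) n).1, (origin_bridge hBL _ n (2 * n)).2⟩

end Summit.CriticalPhenomena.CardyFormulaZ2.Cruxes.IKMixedBoxCrossing.DefectClosureExploration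

end
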